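import Summits.MatrixMultiplication.MatrixMultiplication.Theorems.SoloInformedValInducedMatching

/-!
# The two-block family: a superlinear normal-form configuration without accidental solutions

Dossier `val-superlinear.md` (15.4)(b)/(15.6)(e)/(15.7), claim c533.  In `G = (ZMod ℓ)³` take the two
"rotated axis blocks" of [CKSU05, §7] (the simultaneous triple product property family
`S₁ × T₁ × U₁ = ⟨e₁⟩* × ⟨e₂⟩* × ⟨e₃⟩*`, `S₂ × T₂ × U₂ = ⟨e₂⟩* × ⟨e₃⟩* × ⟨e₁⟩*`, stars meaning non-zero
multiples), written in the NORMAL FORM of `SoloInformedValInducedMatching`: index types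
`I = J = K = Bool × {u : ZMod ℓ // u ≠ 0}` (block bit, non-zero digit), potentials

* `x (false,u) = (u,0,0)`, `x (true,u) = (0,u,0)`,
* `y (false,v) = (0,v,0)`, `y (true,v) = (0,0,v)`,
* `z (false,w) = (0,0,w)`, `z (true,w) = (w,0,0)`,

and pair graphs "same block bit".  We prove:

* `twoBlock_noAccidental` — the configuration has NO ACCIDENTAL SOLUTIONS (the eight block patterns: two are
  the genuine in-block solutions, six force a digit to vanish);
* `card_twoBlock_triangleSet` — it has exactly `2 (ℓ-1)³` triangles, while `|I| = |J| = |K| = 2 (ℓ-1)` and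
  `|G| = ℓ³` (`card_twoBlockIndex`, `card_twoBlockGroup`);
* `twoBlock_ratio` — hence `T³ · ℓ⁶ = (|G|² · |I| |J| |K|) · (ℓ-1)⁶`: the quotient `T³ / (|G|² |I| |J| |K|)` of
  question (U2𝒩) equals `((ℓ-1)/ℓ)⁶`, which tends to `1`; so (U2𝒩) — `T³ ≤ |G|²·|I||J||K|` for every
  normal-form configuration without accidental solutions — cannot be improved by any constant factor;
* `twoBlock_superlinear` — for `ℓ ≥ 5` the configuration is superlinear, `|G| < T` (e.g. `ℓ = 5`:
  `128` triangles in a group of order `125`), so the hypothesis `ν ≤ 1` in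
  `NoAccidental.card_triangles_le_card_of_crossClosed` cannot be dropped (here every pair graph has induced
  matchings of size `2`, and `T ≤ 2 |G|` from `NoAccidental.card_triangles_le_mul` is tight up to `(1 - 1/ℓ)³`).

Elementary; the point is a kernel-certified superlinear member of the normal-form class.
-/

namespace Summit.MatrixMultiplication.MatrixMultiplication.Theorems.SoloVal

open Finset

section TwoBlock

variable (ℓ : ℕ)

/-- The group `(ZMod ℓ)³`. -/
abbrev TwoBlockGroup : Type := ZMod ℓ × ZMod ℓ × ZMod ℓ

/-- The index type of each of the three classes: a block bit and a non-zero digit. -/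
abbrev TwoBlockIndex : Type := Bool × {u : ZMod ℓ // u ≠ 0}

/-- `x`-potentials: block `false` on the first axis, block `true` on the second. -/
def tbX : TwoBlockIndex ℓ → TwoBlockGroup ℓ
  | (false, u) => (u.1, 0, 0)
  | (true, u) => (0, u.1, 0)

/-- `y`-potentials: block `false` on the second axis, block `true` on the third. -/
def tbY : TwoBlockIndex ℓ → TwoBlockGroup ℓ
  | (false, v) => (0, v.1, 0)
  | (true, v) => (0, 0, v.1)

/-- `z`-potentials: block `false` on the third axis, block `true` on the first. -/
def tbZ : TwoBlockIndex ℓ → TwoBlockGroup ℓ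
  | (false, w) => (0, 0, w.1)
  | (true, w) => (w.1, 0, 0)

variable {ℓ}

/-- The `x`-potential of block `false`. -/
theorem tbX_false (u : {u : ZMod ℓ // u ≠ 0}) : tbX ℓ (false, u) = (u.1, 0, 0) := rfl
/-- The `x`-potential of block `true`. -/
theorem tbX_true (u : {u : ZMod ℓ // u ≠ 0}) : tbX ℓ (true, u) = (0, u.1, 0) := rfl
/-- The `y`-potential of block `false`. -/
theorem tbY_false (u : {u : ZMod ℓ // u ≠ 0}) : tbY ℓ (false, u) = (0, u.1, 0) := rfl
/-- The `y`-potential of block `true`. -/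
theorem tbY_true (u : {u : ZMod ℓ // u ≠ 0}) : tbY ℓ (true, u) = (0, 0, u.1) := rfl
/-- The `z`-potential of block `false`. -/
theorem tbZ_false (u : {u : ZMod ℓ // u ≠ 0}) : tbZ ℓ (false, u) = (0, 0, u.1) := rfl
/-- The `z`-potential of block `true`. -/
theorem tbZ_true (u : {u : ZMod ℓ // u ≠ 0}) : tbZ ℓ (true, u) = (u.1, 0, 0) := rfl

/-- The parametrisation of the triangles by (block bit, three digits). -/
def tbTri (q : Bool × {u : ZMod ℓ // u ≠ 0} × {u : ZMod ℓ // u ≠ 0} × {u : ZMod ℓ // u ≠ 0}) :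
    TwoBlockIndex ℓ × TwoBlockIndex ℓ × TwoBlockIndex ℓ :=
  ((q.1, q.2.1), (q.1, q.2.2.1), (q.1, q.2.2.2))

/-- The parametrisation is injective. -/
theorem tbTri_injective : Function.Injective (tbTri (ℓ := ℓ)) := by
  rintro ⟨b, u, v, w⟩ ⟨b', u', v', w'⟩ h
  simp only [tbTri, Prod.mk.injEq] at h
  obtain ⟨⟨hb, hu⟩, ⟨-, hv⟩, -, hw⟩ := h
  subst hb; subst hu; subst hv; subst hw; rfl

variable [NeZero ℓ]

variable (ℓ) in
/-- The pair graph "same block bit" (used for all three pairs of classes). -/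
def tbH : Finset (TwoBlockIndex ℓ × TwoBlockIndex ℓ) :=
  Finset.univ.filter (fun p => p.1.1 = p.2.1)

/-- Membership in the block graph. -/
theorem mem_tbH {p : TwoBlockIndex ℓ × TwoBlockIndex ℓ} : p ∈ tbH ℓ ↔ p.1.1 = p.2.1 := by
  simp [tbH]

/-- NO ACCIDENTAL SOLUTIONS for the two-block family. -/
theorem twoBlock_noAccidental : NoAccidental (tbX ℓ) (tbY ℓ) (tbZ ℓ) (tbH ℓ) (tbH ℓ) (tbH ℓ) := by
  intro i j j' k k' i' hij hjk hki hsum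
  obtain ⟨bi, u₁⟩ := i
  obtain ⟨bj, v₁⟩ := j
  obtain ⟨bj', v₂⟩ := j'
  obtain ⟨bk, w₂⟩ := k
  obtain ⟨bk', w₃⟩ := k'
  obtain ⟨bi', u₃⟩ := i'
  simp only [mem_tbH] at hij hjk hki
  subst hij; subst hjk; subst hki
  have hu₁ := u₁.2; have hv₁ := v₁.2; have hv₂ := v₂.2; have hw₂ := w₂.2; have hw₃ := w₃.2
  have hu₃ := u₃.2
  cases bi <;> cases bj' <;> cases bk' <;>
    simp only [tbX_false, tbX_true, tbY_false, tbY_true, tbZ_false, tbZ_true, Prod.mk_sub_mk,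
      Prod.mk_add_mk, Prod.mk_eq_zero, sub_zero, zero_sub, add_zero, zero_add,
      sub_self, neg_eq_zero, add_neg_eq_zero, neg_add_eq_zero] at hsum <;>
    (obtain ⟨h1, h2, h3⟩ := hsum
     first
     | exact absurd h1 hw₃ | exact absurd h1 hu₃ | exact absurd h2 hu₁ | exact absurd h2 hv₁
     | exact absurd h3 hw₂ | exact absurd h3 hv₂
     | (refine ⟨?_, ?_, ?_⟩ <;> ext <;> simp_all))

/-- The triangles of the two-block family are the same-block triples. -/
theorem mem_twoBlock_triangleSet {τ : TwoBlockIndex ℓ × TwoBlockIndex ℓ × TwoBlockIndex ℓ} :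
    τ ∈ triangleSet (tbH ℓ) (tbH ℓ) (tbH ℓ) ↔ τ.1.1 = τ.2.1.1 ∧ τ.2.1.1 = τ.2.2.1 := by
  rw [mem_triangleSet, IsTriangle]
  simp only [mem_tbH]
  constructor
  · rintro ⟨h1, h2, _⟩; exact ⟨h1, h2⟩
  · rintro ⟨h1, h2⟩; exact ⟨h1, h2, (h1.trans h2).symm⟩

/-- The triangle set is the image of the parametrisation. -/
theorem twoBlock_triangleSet_eq :
    triangleSet (tbH ℓ) (tbH ℓ) (tbH ℓ) = Finset.univ.image (tbTri (ℓ := ℓ)) := by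
  ext τ
  rw [mem_twoBlock_triangleSet, Finset.mem_image]
  constructor
  · rintro ⟨h1, h2⟩
    obtain ⟨⟨b, u⟩, ⟨b', v⟩, ⟨b'', w⟩⟩ := τ
    simp only at h1 h2
    subst h1; subst h2
    exact ⟨(b, u, v, w), Finset.mem_univ _, rfl⟩
  · rintro ⟨q, -, rfl⟩
    exact ⟨rfl, rfl⟩

/-- The number of non-zero digits. -/
theorem card_nonzeroDigit : Fintype.card {u : ZMod ℓ // u ≠ 0} = ℓ - 1 := by
  rw [Fintype.card_subtype_compl, ZMod.card, Fintype.card_subtype_eq]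

/-- `|I| = |J| = |K| = 2 (ℓ - 1)`. -/
theorem card_twoBlockIndex : Fintype.card (TwoBlockIndex ℓ) = 2 * (ℓ - 1) := by
  rw [Fintype.card_prod, Fintype.card_bool, card_nonzeroDigit]

/-- `|G| = ℓ³`. -/
theorem card_twoBlockGroup : Fintype.card (TwoBlockGroup ℓ) = ℓ ^ 3 := by
  simp only [TwoBlockGroup, Fintype.card_prod, ZMod.card]; ring

/-- THE TRIANGLE COUNT: `T = 2 (ℓ - 1)³`. -/
theorem card_twoBlock_triangleSet : (triangleSet (tbH ℓ) (tbH ℓ) (tbH ℓ)).card = 2 * (ℓ - 1) ^ 3 := by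
  rw [twoBlock_triangleSet_eq, Finset.card_image_of_injective _ tbTri_injective, Finset.card_univ,
    Fintype.card_prod, Fintype.card_prod, Fintype.card_prod, Fintype.card_bool, card_nonzeroDigit]
  ring

/-- THE (U2𝒩) QUOTIENT of the two-block family is `((ℓ-1)/ℓ)⁶`, stated without division:
`T³ · ℓ⁶ = (|G|² · |I| |J| |K|) · (ℓ-1)⁶`. -/
theorem twoBlock_ratio :
    (triangleSet (tbH ℓ) (tbH ℓ) (tbH ℓ)).card ^ 3 * ℓ ^ 6 =
      (Fintype.card (TwoBlockGroup ℓ) ^ 2 * (Fintype.card (TwoBlockIndex ℓ) *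
        Fintype.card (TwoBlockIndex ℓ) * Fintype.card (TwoBlockIndex ℓ))) * (ℓ - 1) ^ 6 := by
  rw [card_twoBlock_triangleSet, card_twoBlockGroup, card_twoBlockIndex]
  ring

/-- SUPERLINEARITY: for `ℓ ≥ 5` the two-block family has more triangles than the group has elements. -/
theorem twoBlock_superlinear (h5 : 5 ≤ ℓ) :
    Fintype.card (TwoBlockGroup ℓ) < (triangleSet (tbH ℓ) (tbH ℓ) (tbH ℓ)).card := by
  rw [card_twoBlock_triangleSet, card_twoBlockGroup]
  obtain ⟨m, rfl⟩ : ∃ m, ℓ = m + 1 := ⟨ℓ - 1, by omega⟩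
  have hm : 4 ≤ m := by omega
  simp only [Nat.add_sub_cancel]
  nlinarith [hm, Nat.zero_le m, mul_le_mul hm (le_refl (m * m)) (Nat.zero_le _) (Nat.zero_le _)]

/-- THE PACKAGED STATEMENT (tightness of (U2𝒩) and of the induced-matching bound): for every `ℓ ≥ 1`
there is a normal-form configuration without accidental solutions in a group of order `ℓ³` with three
index classes of size `2(ℓ-1)` and exactly `2(ℓ-1)³` triangles. -/
theorem twoBlock_summary :
    NoAccidental (tbX ℓ) (tbY ℓ) (tbZ ℓ) (tbH ℓ) (tbH ℓ) (tbH ℓ) ∧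
      Fintype.card (TwoBlockGroup ℓ) = ℓ ^ 3 ∧ Fintype.card (TwoBlockIndex ℓ) = 2 * (ℓ - 1) ∧
      (triangleSet (tbH ℓ) (tbH ℓ) (tbH ℓ)).card = 2 * (ℓ - 1) ^ 3 :=
  ⟨twoBlock_noAccidental, card_twoBlockGroup, card_twoBlockIndex, card_twoBlock_triangleSet⟩

end TwoBlock

end Summit.MatrixMultiplication.MatrixMultiplication.Theorems.SoloVal
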